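import Summits.Ventures.YMGap.RobustBall.TruncatedDecayBall
import HarnessLib

/-!
# Venture YMGap, track ROBUST-BALL (Y2) — «C-SMOOTH-BALL» (iii), DOOR-AGNOSTIC CORE: THE TRUNCATED FUNCTIONS OF EVERY ORDER ARE ABSOLUTELY
# SUMMABLE OVER ALL TUPLES OF TERMS OF A DIRECTION OF FINITE EXPONENTIALLY DIAMETER-WEIGHTED LOAD, UNDER ANY STATE WITH COVARIANCE DECAY

HONEST FRAMING. WHAT THIS IS: a venture file (cell `pub-ymgap`, track Y2 ROBUST-BALL, seat rb-p1, theorems only), the summation of the decay bound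
`TruncatedDecayBall.abs_trunc_le_of_covDecay` over tuples.  A probability measure `μ` with the covariance-decay property (constant `C_cov ≥ 0`,
rate `t > 0`; pair door: `C_cov = 8N`; star door: `C_cov = 8N/ρ'`), local observable
`F` (support `Λ_F ≠ ∅`, bound `M_F`, vector `δ_F`), direction terms `V_X` (measurable, local on `X`, Frobenius-Lipschitz witnesses `lipV_X`,
`S_X = Σ_{y∈X} lipV_X y`) of finite EXPONENTIALLY DIAMETER-WEIGHTED LOAD through every link, `Σ'_{X ∋ e} e^{t·dia X} S_X ≤ L_d` for a diameter
majorant `dia ≥ 0`; weights `Φ_n(X) = (2√N+1) S_X e^{(t/n) dia X} e^{−(t/n²) R(X)}`, `R(X) = max_{y∈X} dist(y, Λ_F)`: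
* ★ `sum_weight_le` — pure bookkeeping: `Σ_{X ∈ T} Φ_n(X) ≤ Z_n := (2√N+1) L_d #Λ_F d ((1+r_n)/(1−r_n))^d`, `r_n = e^{−(t/n²)/d}`, for every
  finite family `T` (`e^{−(t/n²)R(X)} ≤ Σ_{e∈X} e^{−(t/n²) dist(e, Λ_F)}`, then `DirectionalSusceptibilityS.sum_mul_sum_le_of_load` and the lattice
  sum `summable_exp_neg_linkSetDist`);
* ★★ `summable_trunc_of_covDecay` — `q ↦ u_{n+1}(F; V^c_{q 0}; …; V^c_{q (n−1)})_μ` IS SUMMABLE OVER ALL `q : Fin n → Finset (links)` with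
  `Σ'_q |u_{n+1}| ≤ A_n Z_nⁿ`, `A_n = cumBound(n+1)(1+C_cov)(M_F + Σδ_F)`: THE `n`-TH ORDER STATIC RESPONSE OF EVERY LOCAL OBSERVABLE AGAINST EVERY
  SUCH DIRECTION IS FINITE, FOR EVERY `n`;
* ★★ `tsum_abs_trunc_snoc_le_of_covDecay` — the fibre domination: `Σ'_X |u_{n+2}(F; V^c_q…; V^c_X)| ≤ A_{n+1} Z_{n+1} ∏_i Φ_{n+1}(q i)`, summable in
  `q` — the domination under which the order-`n` series is differentiated termwise (successor `StateSmoothBall`).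
WHAT THIS IS NOT: the constants grow super-factorially in `n` (no analyticity); nothing continuum / Clay.
-/

noncomputable section

open MeasureTheory Function Finset ProbabilityTheory Real
open scoped NNReal
open Literature.Probability.LatticeModels
open Literature.Probability.LatticeModels.DobrushinMetric
open Literature.MathematicalPhysics.QuantumLattice
open Literature.MathematicalPhysics.QuantumFieldTheory hiding ZdEdge
open Summit.Ventures.YMGap.Cumulants

namespace Summit.Ventures.YMGap.RobustBall

variable {d N : ℕ}

/-- Local shorthand: the outer radius `R(X) = max_{y ∈ X} dist(y, Λ)` of a link set about `Λ` (`0` for `X = ∅`). -/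
local notation3 (prettyPrint := false) "Rad[" Λ "," X "]" =>
  ((Finset.sup X fun y => (linkSetDist Λ y).toNNReal : ℝ≥0) : ℝ)

/-! ### The weights are summable under the exponentially diameter-weighted load -/

/-- ★ **Bookkeeping of the weights.**  `t > 0`, `n ≥ 1`, `Λ_F ≠ ∅`, `lipV ≥ 0`, `dia ≥ 0`, and the exponentially diameter-weighted load
`Σ'_{X ∋ e} e^{t dia X} S_X ≤ L_d` through every link: for every finite family `T` of link sets,
`Σ_{X∈T} (2√N+1) S_X e^{(t/n) dia X} e^{−(t/n²) R(X)} ≤ (2√N+1) L_d (#Λ_F d ((1+r)/(1−r))^d)`, `r = e^{−(t/n²)/d}`. -/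
theorem sum_weight_le (hd : 1 ≤ d) {t : ℝ} (ht : 0 < t) {ΛF : Finset (ZdEdge d)} (hΛF : ΛF.Nonempty)
    {lipV : Finset (ZdEdge d) → ZdEdge d → ℝ} (hlip0 : ∀ X y, 0 ≤ lipV X y)
    {dia : Finset (ZdEdge d) → ℝ} (hdia0 : ∀ X, 0 ≤ dia X) {Ld : ℝ} (hLd0 : 0 ≤ Ld)
    (hLs : ∀ e, Summable fun X : Finset (ZdEdge d) => (if e ∈ X then exp (t * dia X) * ∑ y ∈ X, lipV X y else 0))
    (hL : ∀ e, ∑' X : Finset (ZdEdge d), (if e ∈ X then exp (t * dia X) * ∑ y ∈ X, lipV X y else 0) ≤ Ld)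
    {n : ℕ} (hn : 1 ≤ n) (T : Finset (Finset (ZdEdge d))) :
    ∑ X ∈ T, (2 * Real.sqrt N + 1) * (∑ y ∈ X, lipV X y) * exp (t / n * dia X) * exp (-(t / n ^ 2 * Rad[ΛF, X])) ≤
      (2 * Real.sqrt N + 1) * Ld * (ΛF.card * (d * ((1 + exp (-(t / n ^ 2 / d))) / (1 - exp (-(t / n ^ 2 / d)))) ^ d)) := by
  classical
  have hnR : (1 : ℝ) ≤ n := by exact_mod_cast hn
  have hc : 0 < t / n ^ 2 := by positivity
  have hN1 : (0 : ℝ) ≤ 2 * Real.sqrt N + 1 := by positivity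
  -- the lattice sum
  obtain ⟨hgs, hgle⟩ := summable_exp_neg_linkSetDist hd hc hΛF
  set g : ZdEdge d → ℝ := fun e => exp (-(t / n ^ 2) * linkSetDist ΛF e) with hg
  have hg0 : ∀ e, 0 ≤ g e := fun e => (exp_pos _).le
  -- the scaled load
  set LX : Finset (ZdEdge d) → ℝ := fun X => (2 * Real.sqrt N + 1) * (exp (t * dia X) * ∑ y ∈ X, lipV X y) with hLX
  have hLX0 : ∀ X, 0 ≤ LX X := fun X => mul_nonneg hN1 (mul_nonneg (exp_pos _).le (sum_nonneg fun y _ => hlip0 X y))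
  have hLXs : ∀ e, Summable fun X : Finset (ZdEdge d) => (if e ∈ X then LX X else 0) := fun e => by
    have h := (hLs e).mul_left (2 * Real.sqrt N + 1)
    refine h.congr fun X => ?_
    split_ifs <;> simp [hLX]
  have hLXle : ∀ e, ∑' X : Finset (ZdEdge d), (if e ∈ X then LX X else 0) ≤ (2 * Real.sqrt N + 1) * Ld := fun e => by
    have e1 : (fun X : Finset (ZdEdge d) => (if e ∈ X then LX X else 0)) =
        fun X => (2 * Real.sqrt N + 1) * (if e ∈ X then exp (t * dia X) * ∑ y ∈ X, lipV X y else 0) := by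
      funext X; split_ifs <;> simp [hLX]
    rw [e1, tsum_mul_left]
    exact mul_le_mul_of_nonneg_left (hL e) hN1
  -- pointwise: `Φ_n(X) ≤ LX X · Σ_{e∈X} g e`
  have hpt : ∀ X : Finset (ZdEdge d),
      (2 * Real.sqrt N + 1) * (∑ y ∈ X, lipV X y) * exp (t / n * dia X) * exp (-(t / n ^ 2 * Rad[ΛF, X])) ≤ LX X * ∑ e ∈ X, g e := by
    intro X
    by_cases hX : X.Nonempty
    · obtain ⟨e₀, he₀⟩ := hX
      have h1 : exp (t / n * dia X) ≤ exp (t * dia X) := exp_le_exp.2 (by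
        have : t / n ≤ t := div_le_self ht.le hnR
        nlinarith [hdia0 X])
      have h2 : exp (-(t / n ^ 2 * Rad[ΛF, X])) ≤ ∑ e ∈ X, g e :=
        calc exp (-(t / n ^ 2 * Rad[ΛF, X])) ≤ g e₀ := exp_le_exp.2 (by
              have := linkSetDist_le_rad (Λ := ΛF) he₀
              nlinarith [hc.le])
          _ ≤ ∑ e ∈ X, g e := single_le_sum (f := g) (fun e _ => hg0 e) he₀
      have hS0 : 0 ≤ ∑ y ∈ X, lipV X y := sum_nonneg fun y _ => hlip0 X y
      calc (2 * Real.sqrt N + 1) * (∑ y ∈ X, lipV X y) * exp (t / n * dia X) * exp (-(t / n ^ 2 * Rad[ΛF, X]))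
          ≤ (2 * Real.sqrt N + 1) * (∑ y ∈ X, lipV X y) * exp (t * dia X) * ∑ e ∈ X, g e :=
            mul_le_mul (mul_le_mul_of_nonneg_left h1 (mul_nonneg hN1 hS0)) h2 (exp_pos _).le (by positivity)
        _ = LX X * ∑ e ∈ X, g e := by simp only [hLX]; ring
    · rw [Finset.not_nonempty_iff_eq_empty.1 hX]
      simp
  calc ∑ X ∈ T, (2 * Real.sqrt N + 1) * (∑ y ∈ X, lipV X y) * exp (t / n * dia X) * exp (-(t / n ^ 2 * Rad[ΛF, X]))
      ≤ ∑ X ∈ T, LX X * ∑ e ∈ X, g e := sum_le_sum fun X _ => hpt X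
    _ ≤ (2 * Real.sqrt N + 1) * Ld * ∑' e, g e :=
        sum_mul_sum_le_of_load hg0 hgs hLX0 (mul_nonneg hN1 hLd0) hLXs hLXle
    _ ≤ (2 * Real.sqrt N + 1) * Ld * (ΛF.card * (d * ((1 + exp (-(t / n ^ 2 / d))) / (1 - exp (-(t / n ^ 2 / d)))) ^ d)) :=
        mul_le_mul_of_nonneg_left hgle (mul_nonneg hN1 hLd0)

/-! ### Summability of the truncated functions over tuples, and the fibre domination -/

section SUN

variable {V : Finset (ZdEdge d) → LGConfig d (Matrix.specialUnitaryGroup (Fin N) ℂ) → ℝ}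

/-- ★★ **THE TRUNCATED FUNCTIONS OF EVERY ORDER ARE ABSOLUTELY SUMMABLE OVER ALL TUPLES.**  A probability measure `μ` with the covariance-decay
property (`C_cov ≥ 0`, `t > 0`); `F` bounded measurable local on `Λ_F ≠ ∅` with vector `δ_F`; direction terms
`V_X` measurable, local on `X`, vectors `lipV_X`, with exponentially diameter-weighted load `≤ L_d` for a diameter majorant `dia ≥ 0`.  Then for every
`n`: `q ↦ u_{n+1}(F; V^c_{q 0}; …; V^c_{q (n−1)})_μ` is summable over `Fin n → Finset (links)` and `Σ'_q |u_{n+1}| ≤ A_n Z_nⁿ`. -/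
theorem summable_trunc_of_covDecay (hd : 1 ≤ d) {μ : Measure (LGConfig d (Matrix.specialUnitaryGroup (Fin N) ℂ))} [IsProbabilityMeasure μ]
    {Ccov t : ℝ} (hCcov : 0 ≤ Ccov) (ht : 0 < t)
    (hCov : ∀ (f g : LGConfig d (Matrix.specialUnitaryGroup (Fin N) ℂ) → ℝ) (Δf Δg : Finset (ZdEdge d)) (Mf Mg : ℝ) (δf δg : ZdEdge d → ℝ),
      Measurable f → DependsOn f (↑Δf : Set (ZdEdge d)) → (∀ σ, |f σ| ≤ Mf) → IsLipBound suFrobDist f δf →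
      Measurable g → DependsOn g (↑Δg : Set (ZdEdge d)) → (∀ σ, |g σ| ≤ Mg) → IsLipBound suFrobDist g δg →
        |cov[f, g; μ]| ≤ Ccov * (∑ y ∈ Δg, δg y) * (∑ y ∈ Δf, δf y) * exp (-(t * setDistEdges Δf Δg)))
    {F : LGConfig d (Matrix.specialUnitaryGroup (Fin N) ℂ) → ℝ} (hFm : Measurable F) {ΛF : Finset (ZdEdge d)} (hΛF : ΛF.Nonempty)
    (hFdep : DependsOn F (↑ΛF : Set (ZdEdge d))) {MF : ℝ} (hMF : ∀ σ, |F σ| ≤ MF) {δF : ZdEdge d → ℝ} (hδF : IsLipBound suFrobDist F δF)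
    (hVm : ∀ X, Measurable (V X)) (hVdep : ∀ X, DependsOn (V X) (↑X : Set (ZdEdge d)))
    {lipV : Finset (ZdEdge d) → ZdEdge d → ℝ} (hlipV : ∀ X, IsLipBound suFrobDist (V X) (lipV X))
    {dia : Finset (ZdEdge d) → ℝ} (hdia0 : ∀ X, 0 ≤ dia X) (hdia : ∀ X, ∀ y ∈ X, ∀ z ∈ X, ‖y.1 - z.1‖ ≤ dia X) {Ld : ℝ} (hLd0 : 0 ≤ Ld)
    (hLs : ∀ e, Summable fun X : Finset (ZdEdge d) => (if e ∈ X then exp (t * dia X) * ∑ y ∈ X, lipV X y else 0))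
    (hL : ∀ e, ∑' X : Finset (ZdEdge d), (if e ∈ X then exp (t * dia X) * ∑ y ∈ X, lipV X y else 0) ≤ Ld) (n : ℕ) :
    Summable (fun q : Fin n → Finset (ZdEdge d) => trunc μ F (fun X σ => V X σ - V X 1) q) ∧
      ∑' q : Fin n → Finset (ZdEdge d), |trunc μ F (fun X σ => V X σ - V X 1) q| ≤
        cumBound (n + 1) * (1 + Ccov) * (MF + ∑ y ∈ ΛF, δF y) *
          ((2 * Real.sqrt N + 1) * Ld * (ΛF.card * (d * ((1 + exp (-(t / n ^ 2 / d))) / (1 - exp (-(t / n ^ 2 / d)))) ^ d))) ^ n := by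
  classical
  have hMF0 : 0 ≤ MF := (abs_nonneg _).trans (hMF 1)
  have hSF0 : 0 ≤ ∑ y ∈ ΛF, δF y := sum_nonneg fun y _ => hδF.nonneg y
  have hA0 : 0 ≤ cumBound (n + 1) * (1 + Ccov) * (MF + ∑ y ∈ ΛF, δF y) :=
    mul_nonneg (mul_nonneg (cumBound_pos (n + 1)).le (by linarith)) (add_nonneg hMF0 hSF0)
  have hbound := abs_trunc_le_of_covDecay hCcov ht.le hCov hFm hFdep hMF hδF hVm hVdep hlipV hdia n
  rcases Nat.eq_zero_or_pos n with hn0 | hnpos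
  · subst hn0
    refine ⟨(hasSum_fintype _).summable, ?_⟩
    rw [tsum_fintype, Fintype.sum_unique, pow_zero, mul_one]
    have h := hbound default
    rwa [Finset.univ_eq_empty, Finset.prod_empty, mul_one] at h
  exact summable_pi_of_abs_le_prod hA0
    (fun X => by
      have := sum_nonneg fun y (_ : y ∈ X) => (hlipV X).nonneg y
      positivity)
    (sum_weight_le (N := N) hd ht hΛF (fun X y => (hlipV X).nonneg y) hdia0 hLd0 hLs hL hnpos) hbound

/-- ★★ **THE FIBRE DOMINATION.**  Under the hypotheses of `summable_trunc_of_covDecay`, for every `n` and every `q : Fin n → Finset (links)` the fibre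
`X ↦ u_{n+2}(F; V^c_{q 0}; …; V^c_{q (n−1)}; V^c_X)_μ` is summable with
`Σ'_X |u_{n+2}(…; V^c_X)| ≤ A_{n+1} Z_{n+1} ∏_i Φ_{n+1}(q i)` — a bound summable in `q`. -/
theorem tsum_abs_trunc_snoc_le_of_covDecay (hd : 1 ≤ d) {μ : Measure (LGConfig d (Matrix.specialUnitaryGroup (Fin N) ℂ))} [IsProbabilityMeasure μ]
    {Ccov t : ℝ} (hCcov : 0 ≤ Ccov) (ht : 0 < t)
    (hCov : ∀ (f g : LGConfig d (Matrix.specialUnitaryGroup (Fin N) ℂ) → ℝ) (Δf Δg : Finset (ZdEdge d)) (Mf Mg : ℝ) (δf δg : ZdEdge d → ℝ),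
      Measurable f → DependsOn f (↑Δf : Set (ZdEdge d)) → (∀ σ, |f σ| ≤ Mf) → IsLipBound suFrobDist f δf →
      Measurable g → DependsOn g (↑Δg : Set (ZdEdge d)) → (∀ σ, |g σ| ≤ Mg) → IsLipBound suFrobDist g δg →
        |cov[f, g; μ]| ≤ Ccov * (∑ y ∈ Δg, δg y) * (∑ y ∈ Δf, δf y) * exp (-(t * setDistEdges Δf Δg)))
    {F : LGConfig d (Matrix.specialUnitaryGroup (Fin N) ℂ) → ℝ} (hFm : Measurable F) {ΛF : Finset (ZdEdge d)} (hΛF : ΛF.Nonempty)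
    (hFdep : DependsOn F (↑ΛF : Set (ZdEdge d))) {MF : ℝ} (hMF : ∀ σ, |F σ| ≤ MF) {δF : ZdEdge d → ℝ} (hδF : IsLipBound suFrobDist F δF)
    (hVm : ∀ X, Measurable (V X)) (hVdep : ∀ X, DependsOn (V X) (↑X : Set (ZdEdge d)))
    {lipV : Finset (ZdEdge d) → ZdEdge d → ℝ} (hlipV : ∀ X, IsLipBound suFrobDist (V X) (lipV X))
    {dia : Finset (ZdEdge d) → ℝ} (hdia0 : ∀ X, 0 ≤ dia X) (hdia : ∀ X, ∀ y ∈ X, ∀ z ∈ X, ‖y.1 - z.1‖ ≤ dia X) {Ld : ℝ} (hLd0 : 0 ≤ Ld)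
    (hLs : ∀ e, Summable fun X : Finset (ZdEdge d) => (if e ∈ X then exp (t * dia X) * ∑ y ∈ X, lipV X y else 0))
    (hL : ∀ e, ∑' X : Finset (ZdEdge d), (if e ∈ X then exp (t * dia X) * ∑ y ∈ X, lipV X y else 0) ≤ Ld)
    (n : ℕ) (q : Fin n → Finset (ZdEdge d)) :
    Summable (fun X : Finset (ZdEdge d) => trunc μ F (fun X σ => V X σ - V X 1) (Fin.snoc q X : Fin (n + 1) → Finset (ZdEdge d))) ∧
      ∑' X : Finset (ZdEdge d), |trunc μ F (fun X σ => V X σ - V X 1) (Fin.snoc q X : Fin (n + 1) → Finset (ZdEdge d))| ≤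
        cumBound (n + 2) * (1 + Ccov) * (MF + ∑ y ∈ ΛF, δF y) *
          ((2 * Real.sqrt N + 1) * Ld * (ΛF.card * (d * ((1 + exp (-(t / ↑(n + 1) ^ 2 / d))) / (1 - exp (-(t / ↑(n + 1) ^ 2 / d)))) ^ d))) *
          ∏ i, ((2 * Real.sqrt N + 1) * (∑ y ∈ q i, lipV (q i) y) * exp (t / ↑(n + 1) * dia (q i)) *
            exp (-(t / ↑(n + 1) ^ 2 * Rad[ΛF, q i]))) := by
  classical
  have hMF0 : 0 ≤ MF := (abs_nonneg _).trans (hMF 1)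
  have hSF0 : 0 ≤ ∑ y ∈ ΛF, δF y := sum_nonneg fun y _ => hδF.nonneg y
  set A : ℝ := cumBound (n + 2) * (1 + Ccov) * (MF + ∑ y ∈ ΛF, δF y) with hA
  have hA0 : 0 ≤ A := mul_nonneg (mul_nonneg (cumBound_pos (n + 2)).le (by linarith)) (add_nonneg hMF0 hSF0)
  set Φ : Finset (ZdEdge d) → ℝ := fun X => (2 * Real.sqrt N + 1) * (∑ y ∈ X, lipV X y) * exp (t / ↑(n + 1) * dia X) *
    exp (-(t / ↑(n + 1) ^ 2 * Rad[ΛF, X])) with hΦ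
  have hΦ0 : ∀ X, 0 ≤ Φ X := fun X => by
    have := sum_nonneg fun y (_ : y ∈ X) => (hlipV X).nonneg y
    positivity
  set C : ℝ := A * ∏ i, Φ (q i) with hC
  have hC0 : 0 ≤ C := mul_nonneg hA0 (prod_nonneg fun i _ => hΦ0 _)
  have hbound := abs_trunc_le_of_covDecay hCcov ht.le hCov hFm hFdep hMF hδF hVm hVdep hlipV hdia (n + 1)
  have hpt : ∀ X : Finset (ZdEdge d),
      |trunc μ F (fun X σ => V X σ - V X 1) (Fin.snoc q X : Fin (n + 1) → Finset (ZdEdge d))| ≤ C * Φ X := by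
    intro X
    have h := hbound (Fin.snoc q X)
    rw [Fin.prod_univ_castSucc] at h
    simp only [Fin.snoc_castSucc, Fin.snoc_last] at h
    rw [hC, hA, mul_assoc]
    exact h
  set Z : ℝ := (2 * Real.sqrt N + 1) * Ld *
    (ΛF.card * (d * ((1 + exp (-(t / ↑(n + 1) ^ 2 / d))) / (1 - exp (-(t / ↑(n + 1) ^ 2 / d)))) ^ d)) with hZ
  have hZsum : ∀ T : Finset (Finset (ZdEdge d)), ∑ X ∈ T, C * Φ X ≤ C * Z := fun T => by
    rw [← mul_sum]
    exact mul_le_mul_of_nonneg_left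
      (sum_weight_le (N := N) hd ht hΛF (fun X y => (hlipV X).nonneg y) hdia0 hLd0 hLs hL (Nat.succ_pos n) T) hC0
  have hs : Summable fun X => C * Φ X := summable_of_sum_le (fun X => mul_nonneg hC0 (hΦ0 X)) hZsum
  have hsum : Summable fun X : Finset (ZdEdge d) =>
      |trunc μ F (fun X σ => V X σ - V X 1) (Fin.snoc q X : Fin (n + 1) → Finset (ZdEdge d))| :=
    Summable.of_nonneg_of_le (fun X => abs_nonneg _) hpt hs
  refine ⟨hsum.of_abs, (hsum.tsum_le_tsum hpt hs).trans ?_⟩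
  calc ∑' X, C * Φ X ≤ C * Z := Real.tsum_le_of_sum_le (fun X => mul_nonneg hC0 (hΦ0 X)) hZsum
    _ = A * Z * ∏ i, Φ (q i) := by rw [hC]; ring

end SUN

end Summit.Ventures.YMGap.RobustBall

end
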